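import Summits.HodgeConjecture.HodgeConjecture.Theorems.K2E4WeakMatrixTransportOfTwist   -- ★ p854935 (this seat): twist transport, frame vocabulary
import Literature.NumberTheory.Rogawski1990.ArchBouazizClassMultiplier                   -- ★ `bzClassH`, `bzClassH_conj`, `ArchSmooth₂.classMul` ((T∞) for class-function multipliers)
import HarnessLib

/-!
# K2 · E4 helper — (κ-arch) TRANSPORT UNDER A SMOOTH CLASS-FUNCTION TWIST, (T∞) DISCHARGED («socket #21 modulo the twist data only»)

Cell `pub/hodgecm-mathlib`, Track B «K2-LIT», seat `hodgecm-mathlib-K2E4-p21` (g0); crux H413 = `stmt-HodgeConjecture-24833` (supports-only helper, count-neutral).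
THEOREMS ONLY (no definition, no instance, no notation, no named fact, no `sorry`).

★ `K2E4WeakMatrixTransportOfTwist.archKappaTransport_of_delta_eq_classFun_mul` transports (κ-arch) from `T′` to a twisted factor `T = ψ(γ_H) · T′` modulo the hypothesis
(T∞) «`C_c^∞(H_∞)` (★ `ArchSmooth₂`) is closed under `a^H ↦ ρ · a^H`» for the inverse multiplier `ρ`.  For the natural class of multipliers at `∞` — SMOOTH FUNCTIONS OF THE
CLASS MAP, `ρ = F ∘ cl_H` with `cl_H = ★ bzClassH L : H_∞ → (W → ℂ × ℂ × ℂ)` (`(tr A_w, det A_w, b_w)_w`, Bouaziz's coordinates on the classes) and `F` of class `C^∞` — (T∞) IS ★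
`ArchSmooth₂.classMul`, conjugation invariance IS ★ `bzClassH_conj`, and constancy on stable classes is §1 below.  Hence (κ-arch)[T′, cinf₁] ⟹ (κ-arch)[T, cinf₁ · F(cl_H x₀)] with NO
analytic hypothesis left (§2), and socket #21's `(Hcan) → (Hweak)` holds VERBATIM whenever the weak `Tinf` is such a twist of `Δ‴_∞(μ)` on the `G`-regular pairs with
`F(cl_H(γ_H ⊗ 1)) ≠ 0` (§3) — e.g. the archimedean component of an automorphic character twist, or r01's phase twists `e(o_∞ ∘ σ)`, `σ = tr²∕det − 2` (a smooth function of
`cl_H` on `det ≠ 0`, after a plateau cut-off).  What remains of #21 proper is ONLY the rigidity statement «every `hCTM ∕ hACS`-admissible weak `Tinf` is such a twist near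
`γ_H ⊗ 1`» (NOT IN PRINT).

* §1 `bzClassH_eq_of_isArchStablyConjH`.
* §2 **`archKappaTransport_of_delta_eq_bzClassFun_mul`** (any functional ∕ point; hypothesis-free beyond the twist data).
* §3 **`weakMatrixArchTransport_of_classTwist`** (socket #21's implication with its functional and point verbatim).

HONEST LABEL: HC_CM is proved only modulo the 7 printed citations (2 remaining named inputs: hLiu418 = stmt-HodgeConjecture-24832, h413 = stmt-HodgeConjecture-24833)
until rung 0 closes; this file proves no printed statement and does not pay socket #21.

## References
* [Rogawski1990] J. D. Rogawski, *Automorphic Representations of Unitary Groups in Three Variables*, Ann. of Math. Stud. 123 (1990): §3.1 p. 19, §3.6 p. 31 (classes);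
  §4.3 (4.3.1) p. 43; §4.9 p. 55; Prop. 8.2.1 (a) p. 118; §14.3 pp. 233–234.
* [Bouaziz1994IntegralesOrbitales] A. Bouaziz, Intégrales orbitales sur les algèbres de Lie réductives, Invent. Math. 115 (1994), §2.3 p. 578, §5.1 p. 588.
* [LanglandsShelstad1987] R. P. Langlands, D. Shelstad, On the definition of transfer factors, Math. Ann. 278 (1987), §4.2.
-/

set_option autoImplicit false
set_option linter.dupNamespace false

noncomputable section

open MeasureTheory Measure NumberField NumberField.InfinitePlace NumberField.mixedEmbedding IsDedekindDomain Matrix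
open Literature.NumberTheory.Rogawski1990 Literature.NumberTheory.Automorphic Literature.NumberTheory.Automorphic.UnitaryGroup
open Literature.NumberTheory.GaloisRepresentations
open Summit.HodgeConjecture.HodgeConjecture.Cruxes.H413.K2E4WeakMatrixTransportOfTwist (archKappaTransport_of_delta_eq_classFun_mul)
open scoped Classical Matrix MatrixGroups ContDiff

namespace Summit.HodgeConjecture.HodgeConjecture.Cruxes.H413.K2E4WeakMatrixArchTransportOfClassTwist

variable (L : Type) [Field L] [NumberField L] [IsCMField L]

/-! ## §1 The class map is constant on stable classes -/

/-- **The class map is constant on STABLE classes of `H_∞`**: `IsArchStablyConjH L a b → bzClassH L b = bzClassH L a` (stable conjugacy at `∞` is conjugacy in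
`GL₂(L ⊗ ℝ) × GL₁(L ⊗ ℝ)`, ★ `isStablyConj_iff`; at each complex place `w` the place components are the images under the evaluation ring map `x ↦ x_w` (★ `snd_coe_fst_apply`,
`snd_coe_snd_apply`, definitional), so traces and determinants agree (Mathlib `Matrix.trace_mul_cycle`, `Matrix.det_mul`) and `1 × 1` conjugates are equal).
[cite: Rogawski1990, §3.1 p. 19; §3.6 p. 31] [cite: Bouaziz1994IntegralesOrbitales, §2.3 p. 578] -/
theorem bzClassH_eq_of_isArchStablyConjH
    {a b : ↥(arch (↥(maximalRealSubfield L)) L (IsCMField.complexConj L) 2 (Matrix.of fun i j : Fin 2 => if i.val + j.val + 1 = 2 then (1 : L) else 0)) ×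
      ↥(arch (↥(maximalRealSubfield L)) L (IsCMField.complexConj L) 1 (Matrix.of fun i j : Fin 1 => if i.val + j.val + 1 = 1 then (1 : L) else 0))}
    (h : IsArchStablyConjH L a b) : bzClassH L b = bzClassH L a := by
  obtain ⟨h₁, h₂⟩ := h
  obtain ⟨c₁, hc₁⟩ := isConj_iff.mp h₁
  obtain ⟨c₂, hc₂⟩ := isConj_iff.mp h₂
  funext w
  -- the place-`w` evaluation ring hom `mixedSpace L →+* ℂ`
  let φ : mixedSpace L →+* ℂ := (Pi.evalRingHom (fun _ : {w : InfinitePlace L // IsComplex w} => ℂ) w).comp (RingHom.snd _ _)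
  -- place components as images of the mixed-space matrices
  have hA : ∀ k : ↥(arch (↥(maximalRealSubfield L)) L (IsCMField.complexConj L) 2 (Matrix.of fun i j : Fin 2 => if i.val + j.val + 1 = 2 then (1 : L) else 0)) ×
      ↥(arch (↥(maximalRealSubfield L)) L (IsCMField.complexConj L) 1 (Matrix.of fun i j : Fin 1 => if i.val + j.val + 1 = 1 then (1 : L) else 0)),
      ((archPiEquivCM 2 L (Matrix.of fun i j : Fin 2 => if i.val + j.val + 1 = 2 then (1 : L) else 0) k.1 w : GL (Fin 2) ℂ) : Matrix (Fin 2) (Fin 2) ℂ) =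
        φ.mapMatrix ((k.1.val : GL (Fin 2) (mixedSpace L)) : Matrix (Fin 2) (Fin 2) (mixedSpace L)) := fun k => by
    ext i j
    rw [RingHom.mapMatrix_apply, Matrix.map_apply]
    exact (snd_coe_fst_apply L k w i j).symm
  have hB : ∀ k : ↥(arch (↥(maximalRealSubfield L)) L (IsCMField.complexConj L) 2 (Matrix.of fun i j : Fin 2 => if i.val + j.val + 1 = 2 then (1 : L) else 0)) ×
      ↥(arch (↥(maximalRealSubfield L)) L (IsCMField.complexConj L) 1 (Matrix.of fun i j : Fin 1 => if i.val + j.val + 1 = 1 then (1 : L) else 0)),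
      (((archPiEquivCM 1 L (Matrix.of fun i j : Fin 1 => if i.val + j.val + 1 = 1 then (1 : L) else 0) k.2 w : GL (Fin 1) ℂ) : Matrix (Fin 1) (Fin 1) ℂ)) 0 0 =
        φ ((((k.2.val : GL (Fin 1) (mixedSpace L)) : Matrix (Fin 1) (Fin 1) (mixedSpace L))) 0 0) := fun k =>
    (snd_coe_snd_apply L k w).symm
  -- conjugate the `U(Φ₂)`-components at the place `w`: `B_w = P · A_w · Q` with `Q · P = 1 = P · Q`
  set P : Matrix (Fin 2) (Fin 2) ℂ := φ.mapMatrix ((c₁ : GL (Fin 2) (mixedSpace L)) : Matrix (Fin 2) (Fin 2) (mixedSpace L)) with hP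
  set Q : Matrix (Fin 2) (Fin 2) ℂ := φ.mapMatrix ((c₁⁻¹ : GL (Fin 2) (mixedSpace L)) : Matrix (Fin 2) (Fin 2) (mixedSpace L)) with hQ
  have hQP : Q * P = 1 := by
    rw [hP, hQ, ← map_mul, ← Units.val_mul, inv_mul_cancel, Units.val_one, map_one]
  have hPQ : P * Q = 1 := by
    rw [hP, hQ, ← map_mul, ← Units.val_mul, mul_inv_cancel, Units.val_one, map_one]
  have hconj₁ : φ.mapMatrix ((b.1.val : GL (Fin 2) (mixedSpace L)) : Matrix (Fin 2) (Fin 2) (mixedSpace L)) =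
      P * φ.mapMatrix ((a.1.val : GL (Fin 2) (mixedSpace L)) : Matrix (Fin 2) (Fin 2) (mixedSpace L)) * Q := by
    have := congrArg (fun u : GL (Fin 2) (mixedSpace L) => φ.mapMatrix (u : Matrix (Fin 2) (Fin 2) (mixedSpace L))) hc₁
    simp only [Units.val_mul, map_mul] at this
    rw [← this]
  have htr : (P * φ.mapMatrix ((a.1.val : GL (Fin 2) (mixedSpace L)) : Matrix (Fin 2) (Fin 2) (mixedSpace L)) * Q).trace =
      (φ.mapMatrix ((a.1.val : GL (Fin 2) (mixedSpace L)) : Matrix (Fin 2) (Fin 2) (mixedSpace L))).trace := by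
    rw [Matrix.trace_mul_cycle, hQP, one_mul]
  have hdet : (P * φ.mapMatrix ((a.1.val : GL (Fin 2) (mixedSpace L)) : Matrix (Fin 2) (Fin 2) (mixedSpace L)) * Q).det =
      (φ.mapMatrix ((a.1.val : GL (Fin 2) (mixedSpace L)) : Matrix (Fin 2) (Fin 2) (mixedSpace L))).det := by
    rw [Matrix.det_mul, Matrix.det_mul, mul_right_comm, ← Matrix.det_mul, hPQ, Matrix.det_one, one_mul]
  -- the `U(Φ₁)`-components: `1 × 1` matrices commute, so conjugate entries are equal
  have hconj₂ : φ ((((b.2.val : GL (Fin 1) (mixedSpace L)) : Matrix (Fin 1) (Fin 1) (mixedSpace L))) 0 0) =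
      φ ((((a.2.val : GL (Fin 1) (mixedSpace L)) : Matrix (Fin 1) (Fin 1) (mixedSpace L))) 0 0) := by
    have := congrArg (fun u : GL (Fin 1) (mixedSpace L) => φ.mapMatrix (u : Matrix (Fin 1) (Fin 1) (mixedSpace L))) hc₂
    simp only [Units.val_mul, map_mul] at this
    have hcomm : ∀ (x y : Matrix (Fin 1) (Fin 1) ℂ), x * y = y * x := fun x y => by
      ext i j; fin_cases i; fin_cases j; simp [Matrix.mul_apply, mul_comm]
    have hinv : φ.mapMatrix ((c₂ : GL (Fin 1) (mixedSpace L)) : Matrix (Fin 1) (Fin 1) (mixedSpace L)) *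
        φ.mapMatrix ((c₂⁻¹ : GL (Fin 1) (mixedSpace L)) : Matrix (Fin 1) (Fin 1) (mixedSpace L)) = 1 := by
      rw [← map_mul, ← Units.val_mul, mul_inv_cancel, Units.val_one, map_one]
    rw [hcomm (φ.mapMatrix _) (φ.mapMatrix ((a.2.val : GL (Fin 1) (mixedSpace L)) : Matrix (Fin 1) (Fin 1) (mixedSpace L))), mul_assoc, hinv,
      mul_one] at this
    have e := congrArg (fun M : Matrix (Fin 1) (Fin 1) ℂ => M 0 0) this
    simp only [RingHom.mapMatrix_apply, Matrix.map_apply] at e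
    exact e.symm
  rw [bzClassH_apply, bzClassH_apply, hA b, hA a, hB b, hB a, hconj₁, htr, hdet, hconj₂]


/-! ## §2 (κ-arch) transport under a smooth class-function twist — no analytic hypothesis left -/

variable (H' : Matrix (Fin 3) (Fin 3) L)

/-- **κ-TRANSPORT under a smooth class-function twist at `∞`** (any functional ∕ point): archimedean transfer factors `T, T′` with `T.Δ(γ_H, γ′) = ψ(γ_H) · T′.Δ(γ_H, γ′)` at the
`G`-regular `γ_H ∈ H_∞`, and `F : (W → ℂ × ℂ × ℂ) → ℂ` of class `C^∞` with `F(cl_H γ_H) · ψ(γ_H) = 1` at the `G`-regular `γ_H` and `F(cl_H x₀) ≠ 0`.  Then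
(κ-arch)[T′, cinf₁] ⟹ (κ-arch)[T, cinf₁ · F(cl_H x₀)] — conjugation invariance ★ `bzClassH_conj`, stable constancy §1, (T∞) ★ `ArchSmooth₂.classMul`.
[cite: Rogawski1990, §14.3 pp. 233–234; Prop. 8.2.1 (a) p. 118; §4.9 p. 55] [cite: Bouaziz1994IntegralesOrbitales, §5.1 p. 588] -/
theorem archKappaTransport_of_delta_eq_bzClassFun_mul
    {_ha : ∀ a : (UnitaryGroup.arch (↥(maximalRealSubfield L)) L (IsCMField.complexConj L) 2
          (Matrix.of fun i j : Fin 2 => if i.val + j.val + 1 = 2 then (1 : L) else 0) ×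
        UnitaryGroup.arch (↥(maximalRealSubfield L)) L (IsCMField.complexConj L) 1
          (Matrix.of fun i j : Fin 1 => if i.val + j.val + 1 = 1 then (1 : L) else 0)),
      MeasurableSpace ((UnitaryGroup.arch (↥(maximalRealSubfield L)) L (IsCMField.complexConj L) 2
          (Matrix.of fun i j : Fin 2 => if i.val + j.val + 1 = 2 then (1 : L) else 0) ×
        UnitaryGroup.arch (↥(maximalRealSubfield L)) L (IsCMField.complexConj L) 1
          (Matrix.of fun i j : Fin 1 => if i.val + j.val + 1 = 1 then (1 : L) else 0)) ⧸
        Subgroup.centralizer ({a} : Set (UnitaryGroup.arch (↥(maximalRealSubfield L)) L (IsCMField.complexConj L) 2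
          (Matrix.of fun i j : Fin 2 => if i.val + j.val + 1 = 2 then (1 : L) else 0) ×
        UnitaryGroup.arch (↥(maximalRealSubfield L)) L (IsCMField.complexConj L) 1
          (Matrix.of fun i j : Fin 1 => if i.val + j.val + 1 = 1 then (1 : L) else 0))))}
    {_hγ : ∀ γ : UnitaryGroup.arch (↥(maximalRealSubfield L)) L (IsCMField.complexConj L) 3 H',
      MeasurableSpace (UnitaryGroup.arch (↥(maximalRealSubfield L)) L (IsCMField.complexConj L) 3 H' ⧸
        Subgroup.centralizer ({γ} : Set (UnitaryGroup.arch (↥(maximalRealSubfield L)) L (IsCMField.complexConj L) 3 H')))}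
    {T T' : ArchTransferFactor L H'} (ψ : (UnitaryGroup.arch (↥(maximalRealSubfield L)) L (IsCMField.complexConj L) 2
          (Matrix.of fun i j : Fin 2 => if i.val + j.val + 1 = 2 then (1 : L) else 0) ×
        UnitaryGroup.arch (↥(maximalRealSubfield L)) L (IsCMField.complexConj L) 1
          (Matrix.of fun i j : Fin 1 => if i.val + j.val + 1 = 1 then (1 : L) else 0)) → ℂ)
    {F : ({w : InfinitePlace L // IsComplex w} → ℂ × ℂ × ℂ) → ℂ} (hF : ContDiff ℝ ∞ F)
    (hFψ : ∀ a : (UnitaryGroup.arch (↥(maximalRealSubfield L)) L (IsCMField.complexConj L) 2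
          (Matrix.of fun i j : Fin 2 => if i.val + j.val + 1 = 2 then (1 : L) else 0) ×
        UnitaryGroup.arch (↥(maximalRealSubfield L)) L (IsCMField.complexConj L) 1
          (Matrix.of fun i j : Fin 1 => if i.val + j.val + 1 = 1 then (1 : L) else 0)), IsArchGRegular L a → F (bzClassH L a) * ψ a = 1)
    (hT : ∀ (γH : (UnitaryGroup.arch (↥(maximalRealSubfield L)) L (IsCMField.complexConj L) 2
          (Matrix.of fun i j : Fin 2 => if i.val + j.val + 1 = 2 then (1 : L) else 0) ×
        UnitaryGroup.arch (↥(maximalRealSubfield L)) L (IsCMField.complexConj L) 1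
          (Matrix.of fun i j : Fin 1 => if i.val + j.val + 1 = 1 then (1 : L) else 0)))
        (γ' : UnitaryGroup.arch (↥(maximalRealSubfield L)) L (IsCMField.complexConj L) 3 H'),
        IsArchGRegular L γH → T.Δ γH γ' = ψ γH * T'.Δ γH γ')
    (mHi : OrbitalMeasureFamily (UnitaryGroup.arch (↥(maximalRealSubfield L)) L (IsCMField.complexConj L) 2
          (Matrix.of fun i j : Fin 2 => if i.val + j.val + 1 = 2 then (1 : L) else 0) ×
        UnitaryGroup.arch (↥(maximalRealSubfield L)) L (IsCMField.complexConj L) 1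
          (Matrix.of fun i j : Fin 1 => if i.val + j.val + 1 = 1 then (1 : L) else 0)))
    (m' : OrbitalMeasureFamily (UnitaryGroup.arch (↥(maximalRealSubfield L)) L (IsCMField.complexConj L) 3 H'))
    (Φ : (UnitaryGroup.arch (↥(maximalRealSubfield L)) L (IsCMField.complexConj L) 3 H' → ℂ) → ℂ)
    {x₀ : (UnitaryGroup.arch (↥(maximalRealSubfield L)) L (IsCMField.complexConj L) 2
          (Matrix.of fun i j : Fin 2 => if i.val + j.val + 1 = 2 then (1 : L) else 0) ×
        UnitaryGroup.arch (↥(maximalRealSubfield L)) L (IsCMField.complexConj L) 1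
          (Matrix.of fun i j : Fin 1 => if i.val + j.val + 1 = 1 then (1 : L) else 0))} (hx₀ : F (bzClassH L x₀) ≠ 0) {cinf₁ : ℂ} (h₁ : cinf₁ ≠ 0)
    (h : ∀ (aH : (UnitaryGroup.arch (↥(maximalRealSubfield L)) L (IsCMField.complexConj L) 2
          (Matrix.of fun i j : Fin 2 => if i.val + j.val + 1 = 2 then (1 : L) else 0) ×
        UnitaryGroup.arch (↥(maximalRealSubfield L)) L (IsCMField.complexConj L) 1
          (Matrix.of fun i j : Fin 1 => if i.val + j.val + 1 = 1 then (1 : L) else 0)) → ℂ)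
        (a : UnitaryGroup.arch (↥(maximalRealSubfield L)) L (IsCMField.complexConj L) 3 H' → ℂ),
        ArchSmooth L 3 H' a → ArchSmooth₂ L aH → IsArchDeltaTransfer L H' T' mHi m' aH a → Φ a = cinf₁ * aH x₀) :
    ∃ cinf : ℂ, cinf ≠ 0 ∧
      ∀ (aH : (UnitaryGroup.arch (↥(maximalRealSubfield L)) L (IsCMField.complexConj L) 2
          (Matrix.of fun i j : Fin 2 => if i.val + j.val + 1 = 2 then (1 : L) else 0) ×
        UnitaryGroup.arch (↥(maximalRealSubfield L)) L (IsCMField.complexConj L) 1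
          (Matrix.of fun i j : Fin 1 => if i.val + j.val + 1 = 1 then (1 : L) else 0)) → ℂ)
        (a : UnitaryGroup.arch (↥(maximalRealSubfield L)) L (IsCMField.complexConj L) 3 H' → ℂ),
        ArchSmooth L 3 H' a → ArchSmooth₂ L aH → IsArchDeltaTransfer L H' T mHi m' aH a → Φ a = cinf * aH x₀ :=
  archKappaTransport_of_delta_eq_classFun_mul L H' ψ (fun y => F (bzClassH L y))
    (fun g x => congrArg F (bzClassH_conj L g x)) (fun _ _ _ hb => congrArg F (bzClassH_eq_of_isArchStablyConjH L hb)) hFψ hT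
    (fun _ haH => ArchSmooth₂.classMul L haH hF) mHi m' Φ hx₀ h₁ h

/-! ## §3 Socket #21 modulo the twist data only -/

/-- **SOCKET #21 MODULO THE TWIST DATA** — `sig_K2E4WeakMatrixArchTransport`'s implication `(Hcan) → (Hweak)` with its functional (`Φ^st(γ₀ ⊗ 1, a)` against ★
`archSingularTopFormFamily L H′ νGi`) and its point `γ_H ⊗ 1` VERBATIM, when the weak `Tinf` is a twist `ψ · Δ‴_∞(μ)` on the `G`-regular pairs whose inverse multiplier is a
smooth function `F` of the class map (`F(cl_H γ_H) · ψ(γ_H) = 1` at the `G`-regular `γ_H`) with `F(cl_H(γ_H ⊗ 1)) ≠ 0`; the constant moves by `F(cl_H(γ_H ⊗ 1))`.  No analytic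
hypothesis remains; the rigidity «every admissible weak `Tinf` is such a twist» is NOT claimed. [cite: Rogawski1990, Prop. 8.2.1 (a) p. 118; §14.3 pp. 233–234; §14.6 p. 242] -/
theorem weakMatrixArchTransport_of_classTwist
    [MeasurableSpace (UnitaryGroup.arch (↥(maximalRealSubfield L)) L (IsCMField.complexConj L) 3 H')]
    [BorelSpace (UnitaryGroup.arch (↥(maximalRealSubfield L)) L (IsCMField.complexConj L) 3 H')]
    [∀ γ : UnitaryGroup.arch (↥(maximalRealSubfield L)) L (IsCMField.complexConj L) 3 H',
      MeasurableSpace (UnitaryGroup.arch (↥(maximalRealSubfield L)) L (IsCMField.complexConj L) 3 H' ⧸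
        Subgroup.centralizer ({γ} : Set (UnitaryGroup.arch (↥(maximalRealSubfield L)) L (IsCMField.complexConj L) 3 H')))]
    [∀ γ : UnitaryGroup.arch (↥(maximalRealSubfield L)) L (IsCMField.complexConj L) 3 H',
      BorelSpace (UnitaryGroup.arch (↥(maximalRealSubfield L)) L (IsCMField.complexConj L) 3 H' ⧸
        Subgroup.centralizer ({γ} : Set (UnitaryGroup.arch (↥(maximalRealSubfield L)) L (IsCMField.complexConj L) 3 H')))]
    [∀ a : (UnitaryGroup.arch (↥(maximalRealSubfield L)) L (IsCMField.complexConj L) 2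
          (Matrix.of fun i j : Fin 2 => if i.val + j.val + 1 = 2 then (1 : L) else 0) ×
        UnitaryGroup.arch (↥(maximalRealSubfield L)) L (IsCMField.complexConj L) 1
          (Matrix.of fun i j : Fin 1 => if i.val + j.val + 1 = 1 then (1 : L) else 0)),
      MeasurableSpace ((UnitaryGroup.arch (↥(maximalRealSubfield L)) L (IsCMField.complexConj L) 2
          (Matrix.of fun i j : Fin 2 => if i.val + j.val + 1 = 2 then (1 : L) else 0) ×
        UnitaryGroup.arch (↥(maximalRealSubfield L)) L (IsCMField.complexConj L) 1
          (Matrix.of fun i j : Fin 1 => if i.val + j.val + 1 = 1 then (1 : L) else 0)) ⧸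
        Subgroup.centralizer ({a} : Set (UnitaryGroup.arch (↥(maximalRealSubfield L)) L (IsCMField.complexConj L) 2
          (Matrix.of fun i j : Fin 2 => if i.val + j.val + 1 = 2 then (1 : L) else 0) ×
        UnitaryGroup.arch (↥(maximalRealSubfield L)) L (IsCMField.complexConj L) 1
          (Matrix.of fun i j : Fin 1 => if i.val + j.val + 1 = 1 then (1 : L) else 0))))]
    (Tinf : ArchTransferFactor L H') (νGi : Measure (UnitaryGroup.arch (↥(maximalRealSubfield L)) L (IsCMField.complexConj L) 3 H'))
    [IsFiniteMeasureOnCompacts νGi] [νGi.IsMulRightInvariant]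
    (m' : OrbitalMeasureFamily (UnitaryGroup.arch (↥(maximalRealSubfield L)) L (IsCMField.complexConj L) 3 H'))
    (mHi : OrbitalMeasureFamily (UnitaryGroup.arch (↥(maximalRealSubfield L)) L (IsCMField.complexConj L) 2
          (Matrix.of fun i j : Fin 2 => if i.val + j.val + 1 = 2 then (1 : L) else 0) ×
        UnitaryGroup.arch (↥(maximalRealSubfield L)) L (IsCMField.complexConj L) 1
          (Matrix.of fun i j : Fin 1 => if i.val + j.val + 1 = 1 then (1 : L) else 0)))
    (μ : HeckeCharacter L) (ψ : (UnitaryGroup.arch (↥(maximalRealSubfield L)) L (IsCMField.complexConj L) 2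
          (Matrix.of fun i j : Fin 2 => if i.val + j.val + 1 = 2 then (1 : L) else 0) ×
        UnitaryGroup.arch (↥(maximalRealSubfield L)) L (IsCMField.complexConj L) 1
          (Matrix.of fun i j : Fin 1 => if i.val + j.val + 1 = 1 then (1 : L) else 0)) → ℂ)
    {F : ({w : InfinitePlace L // IsComplex w} → ℂ × ℂ × ℂ) → ℂ} (hF : ContDiff ℝ ∞ F)
    (hFψ : ∀ a : (UnitaryGroup.arch (↥(maximalRealSubfield L)) L (IsCMField.complexConj L) 2
          (Matrix.of fun i j : Fin 2 => if i.val + j.val + 1 = 2 then (1 : L) else 0) ×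
        UnitaryGroup.arch (↥(maximalRealSubfield L)) L (IsCMField.complexConj L) 1
          (Matrix.of fun i j : Fin 1 => if i.val + j.val + 1 = 1 then (1 : L) else 0)), IsArchGRegular L a → F (bzClassH L a) * ψ a = 1)
    (htwist : ∀ (γH : (UnitaryGroup.arch (↥(maximalRealSubfield L)) L (IsCMField.complexConj L) 2
          (Matrix.of fun i j : Fin 2 => if i.val + j.val + 1 = 2 then (1 : L) else 0) ×
        UnitaryGroup.arch (↥(maximalRealSubfield L)) L (IsCMField.complexConj L) 1
          (Matrix.of fun i j : Fin 1 => if i.val + j.val + 1 = 1 then (1 : L) else 0)))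
        (γ' : UnitaryGroup.arch (↥(maximalRealSubfield L)) L (IsCMField.complexConj L) 3 H'),
        IsArchGRegular L γH → Tinf.Δ γH γ' = ψ γH * (archCanonicalTransferFactor L H' μ).Δ γH γ')
    (γ₀ : (UnitaryGroup.cmDatum L 3 H').Rational)
    (γH : (UnitaryGroup.cmDatum L 2 (Matrix.of fun i j : Fin 2 => if i.val + j.val + 1 = 2 then (1 : L) else 0)).Rational ×
      (UnitaryGroup.cmDatum L 1 (Matrix.of fun i j : Fin 1 => if i.val + j.val + 1 = 1 then (1 : L) else 0)).Rational)
    (hx₀ : F (bzClassH L (cmRationalToArch L 2 (Matrix.of fun i j : Fin 2 => if i.val + j.val + 1 = 2 then (1 : L) else 0) γH.1,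
      cmRationalToArch L 1 (Matrix.of fun i j : Fin 1 => if i.val + j.val + 1 = 1 then (1 : L) else 0) γH.2)) ≠ 0) :
    (∃ cinf₁ : ℂ, cinf₁ ≠ 0 ∧
      (∀ (aH : UnitaryGroup.arch (↥(maximalRealSubfield L)) L (IsCMField.complexConj L) 2 (Matrix.of fun i j : Fin 2 => if i.val + j.val + 1 = 2 then (1 : L) else 0) ×
              UnitaryGroup.arch (↥(maximalRealSubfield L)) L (IsCMField.complexConj L) 1 (Matrix.of fun i j : Fin 1 => if i.val + j.val + 1 = 1 then (1 : L) else 0) → ℂ)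
            (a : UnitaryGroup.arch (↥(maximalRealSubfield L)) L (IsCMField.complexConj L) 3 H' → ℂ),
          ArchSmooth L 3 H' a → ArchSmooth₂ L aH → IsArchDeltaTransfer L H' (archCanonicalTransferFactor L H' μ) mHi m' aH a →
          archStableOrbitalIntegral L 3 H' (Literature.NumberTheory.Weil1964.UnitaryArchTopForm.archSingularTopFormFamily L H' νGi) a (cmRationalToArch L 3 H' γ₀) =
            cinf₁ * aH (cmRationalToArch L 2 (Matrix.of fun i j : Fin 2 => if i.val + j.val + 1 = 2 then (1 : L) else 0) γH.1, cmRationalToArch L 1 (Matrix.of fun i j : Fin 1 => if i.val + j.val + 1 = 1 then (1 : L) else 0) γH.2))) →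
    ∃ cinf : ℂ, cinf ≠ 0 ∧
      (∀ (aH : UnitaryGroup.arch (↥(maximalRealSubfield L)) L (IsCMField.complexConj L) 2 (Matrix.of fun i j : Fin 2 => if i.val + j.val + 1 = 2 then (1 : L) else 0) ×
              UnitaryGroup.arch (↥(maximalRealSubfield L)) L (IsCMField.complexConj L) 1 (Matrix.of fun i j : Fin 1 => if i.val + j.val + 1 = 1 then (1 : L) else 0) → ℂ)
            (a : UnitaryGroup.arch (↥(maximalRealSubfield L)) L (IsCMField.complexConj L) 3 H' → ℂ),
          ArchSmooth L 3 H' a → ArchSmooth₂ L aH → IsArchDeltaTransfer L H' Tinf mHi m' aH a →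
          archStableOrbitalIntegral L 3 H' (Literature.NumberTheory.Weil1964.UnitaryArchTopForm.archSingularTopFormFamily L H' νGi) a (cmRationalToArch L 3 H' γ₀) =
            cinf * aH (cmRationalToArch L 2 (Matrix.of fun i j : Fin 2 => if i.val + j.val + 1 = 2 then (1 : L) else 0) γH.1, cmRationalToArch L 1 (Matrix.of fun i j : Fin 1 => if i.val + j.val + 1 = 1 then (1 : L) else 0) γH.2)) := by
  rintro ⟨cinf₁, h₁, h⟩
  exact archKappaTransport_of_delta_eq_bzClassFun_mul L H' ψ hF hFψ htwist mHi m' _ hx₀ h₁ h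

end Summit.HodgeConjecture.HodgeConjecture.Cruxes.H413.K2E4WeakMatrixArchTransportOfClassTwist

end
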